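import Summits.HodgeConjecture.CorCM.MultiFieldWeilCommutantCriterion
import Mathlib.LinearAlgebra.Dimension.Constructions
import Mathlib.LinearAlgebra.LinearIndependent.Lemmas
import HarnessLib

/-!
# MULTI-FIELD WEIL ENGINE — THE RANK BOUND: `s` independent invariant kernels forbid the separation of `⌈k/s⌉` classes of ANY types over one field
# (census level; never `k` classes over a field with `k` `τ`-embeddings; never three over a dihedral decic field, in one stroke)

Cell `pub-hodgecm2` (COR-CM), seat b30 gen 43 (2026-08-26); count-neutral own lane MULTI-FIELD WEIL ENGINE (stem `MultiFieldWeil*`), census level, the COUNTING companion of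
`CorCM/MultiFieldWeilCommutantCriterion.lean` (F1: separated ⟺ commutant-independent).  Theorems only; no definition, no named fact, no `sorry`.  HONEST FRAMING: pure finite
combinatorics ∕ linear algebra; `HC_CM` is NOT touched.

THE RANK BOUND (`exists_nonconst_signed_of_independent_kernels`).  `H ⊆ Sym(k)` arbitrary; `A_1, …, A_s` integer kernels invariant under `H` with zero row and column sums and
LINEARLY INDEPENDENT; position sets `Q_i` (`i ∈ ι`) of ANY shapes with `s·|ι| ≥ k ≥ 1`.  Then the signed equations of the family have an integer solution with a NON-constant
defect: the `s·|ι|` vectors `A_t c_i` live in the mass-zero hyperplane of `ℤ^k` (rank `k − 1 < s·|ι|`; bookkeeping: add the constant vector `𝟙` and count in `ℤ^k`), so they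
satisfy a non-trivial integer relation `Σ_{i,t} g_{i,t} A_t c_i = 0`; the kernels `G_i = Σ_t g_{i,t} A_t` are invariant with zero row sums, not all zero by the independence
of the `A_t`, and F1's `exists_nonconst_signed_of_kernel_relation` applies.  READING (with F1): over an image whose commutant on the mass-zero module has dimension `s`
(`s = r − 1`, `r` the RANK of the image = the number of its orbitals) AT MOST `⌊(k − 1)/s⌋` classes over the field can be separated, whatever their types.
* §2 `exists_nonconst_signed_of_card_ge` (`s = 1`, `A = k·δ − J`, ANY `H`): over a field with `k ≥ 2` `τ`-embeddings the units method NEVER separates `k` classes — the per-field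
  maxima of the menus (two `(1,2)`-classes over a sextic field, three classes over an `𝔄₄`/`𝔖₄`-octic field, four over a decic field with `2`-transitive quintic part;
  `CorCM/MultiFieldWeilUnitSeparation.lean`, `…UnitShapes.lean`) are SHARP.
* §3 `exists_nonconst_signed_of_dihedral_five_card_ge` (`s = 2`, `A = 5·[b − a = ±1] − 2J`, `5·[b − a = ±2] − 2J`): over the dihedral pentagon (rotations and reflections of
  `ℤ/5`) NEVER three classes — gen 42's `exists_nonconst_signed_of_dihedral_three` (six explicit vectors in `ℚ⁵`) recovered from the rank bound in a few lines.
[cite: Serre1977, §2.3 Ex. 2.6; §13.1] [cite: DixonMortimer1996, §3.2 (orbitals, rank, the centraliser algebra)] [cite: Lang2002, XIII §4; XVII §1]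

## References
* [Serre1977] J.-P. Serre, *Linear Representations of Finite Groups*, GTM 42, §2.3 Ex. 2.6, §13.1.
* [DixonMortimer1996] J. D. Dixon, B. Mortimer, *Permutation Groups*, GTM 163, §3.2.
* [Lang2002] S. Lang, *Algebra*, GTM 211, XIII §4 (rank of free modules), XVII §1.
-/

noncomputable section

namespace Summit.HodgeConjecture.CorCM.MultiFieldWeil

open Finset
open Fin.CommRing

open scoped Classical

/-! ## §1 The rank bound -/

section RankBound

variable {k s : ℕ} {H : Finset (Equiv.Perm (Fin k))}

/-- **THE RANK BOUND.**  `H ⊆ Sym(k)` arbitrary; integer kernels `A_t` (`t < s`) invariant under `H`, with zero row and column sums, linearly independent over `ℤ`; position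
sets `Q_i` (`i ∈ ι`) of any shapes with `k ≤ s·|ι|`, `k ≥ 1`.  Then some integer solution of the signed equations `Σ_i Σ_a ±_{σ a ∈ Q_i} u_i(a) = 0` (`σ ∈ H`) has a
NON-constant defect.  See the module docstring. [cite: Serre1977, §2.3 Ex. 2.6; §13.1] [cite: DixonMortimer1996, §3.2] [cite: Lang2002, XIII §4] -/
theorem exists_nonconst_signed_of_independent_kernels {ι : Type} [Fintype ι] [DecidableEq ι]
    (Q : ι → Finset (Fin k)) (A : Fin s → Fin k → Fin k → ℤ)
    (hA : ∀ σ ∈ H, ∀ t a b, A t (σ a) (σ b) = A t a b) (hArow : ∀ t a, ∑ b, A t a b = 0) (hAcol : ∀ t b, ∑ a, A t a b = 0)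
    (hAli : LinearIndependent ℤ A) (hk : 0 < k) (hcount : k ≤ s * Fintype.card ι) :
    ∃ u : ι → Fin k → ℤ, (∃ i a b, u i a ≠ u i b) ∧ ∀ σ ∈ H, (∑ i, ∑ a, if σ a ∈ Q i then u i a else -u i a) = 0 := by
  -- the vectors `A_t c_i` and the constant vector
  set c : ι → Fin k → ℤ := fun i x => (k : ℤ) * (if x ∈ Q i then 1 else 0) - (Q i).card with hc
  set v : Option (ι × Fin s) → Fin k → ℤ := fun o => o.elim (fun _ => 1) fun p => fun a => ∑ b, A p.2 a b * c p.1 b with hv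
  -- too many vectors in `ℤ^k`
  have hdep : ¬ LinearIndependent ℤ v := fun hli => by
    have h := hli.fintype_card_le_finrank
    rw [Fintype.card_option, Fintype.card_prod, Fintype.card_fin, Module.finrank_fin_fun] at h
    have hcomm : s * Fintype.card ι = Fintype.card ι * s := Nat.mul_comm _ _
    omega
  obtain ⟨g, hg, o₀, ho₀⟩ := Fintype.not_linearIndependent_iff.1 hdep
  have hgx : ∀ x, g none + ∑ p : ι × Fin s, g (some p) * ∑ b, A p.2 x b * c p.1 b = 0 := fun x => by
    have := congrFun hg x
    simp only [Finset.sum_apply, Pi.smul_apply, smul_eq_mul, Pi.zero_apply, Fintype.sum_option] at this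
    simpa [hv] using this
  -- the coefficient of the constant vector vanishes (sum over the letters; the `A_t c_i` have mass zero by the zero column sums)
  have hmass : ∀ p : ι × Fin s, ∑ x, ∑ b, A p.2 x b * c p.1 b = 0 := fun p => by
    rw [Finset.sum_comm]
    exact Finset.sum_eq_zero fun b _ => by rw [← Finset.sum_mul, hAcol, zero_mul]
  have hg0 : g none = 0 := by
    have htot : ∑ x : Fin k, (g none + ∑ p : ι × Fin s, g (some p) * ∑ b, A p.2 x b * c p.1 b) = 0 :=
      Finset.sum_eq_zero fun x _ => hgx x
    rw [Finset.sum_add_distrib, Finset.sum_const, Finset.card_univ, Fintype.card_fin, nsmul_eq_mul, Finset.sum_comm] at htot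
    rw [Finset.sum_eq_zero fun p _ => by rw [← Finset.mul_sum, hmass p, mul_zero], add_zero] at htot
    exact (mul_eq_zero.1 htot).resolve_left (by exact_mod_cast hk.ne')
  -- the kernels `G_i = Σ_t g_{i,t} A_t`
  set G : ι → Fin k → Fin k → ℤ := fun i a b => ∑ t, g (some (i, t)) * A t a b with hG
  have hGinv : ∀ σ ∈ H, ∀ i a b, G i (σ a) (σ b) = G i a b := fun σ hσ i a b => by
    simp only [hG]
    exact Finset.sum_congr rfl fun t _ => by rw [hA σ hσ]
  have hG0 : ∀ i b, ∑ a, G i b a = 0 := fun i b => by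
    simp only [hG]
    rw [Finset.sum_comm]
    exact Finset.sum_eq_zero fun t _ => by rw [← Finset.mul_sum, hArow, mul_zero]
  have hrel : ∀ a, ∑ i, ∑ b, G i a b * ((k : ℤ) * (if b ∈ Q i then 1 else 0) - (Q i).card) = 0 := fun a => by
    have e : ∑ i, ∑ b, G i a b * c i b = ∑ p : ι × Fin s, g (some p) * ∑ b, A p.2 a b * c p.1 b := by
      rw [Fintype.sum_prod_type]
      refine Finset.sum_congr rfl fun i _ => ?_
      simp only [hG, Finset.sum_mul, Finset.mul_sum]
      rw [Finset.sum_comm]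
      exact Finset.sum_congr rfl fun t _ => Finset.sum_congr rfl fun b _ => by ring
    have := hgx a
    rw [hg0, zero_add] at this
    rw [e]
    exact this
  -- not all `G_i` vanish
  have hne : ∃ i a b, G i a b ≠ 0 := by
    obtain ⟨p₀, rfl⟩ : ∃ p₀, o₀ = some p₀ := by
      cases o₀ with
      | none => exact absurd hg0 ho₀
      | some p₀ => exact ⟨p₀, rfl⟩
    by_contra hno
    push Not at hno
    have hfun : ∑ t, (fun t' => g (some (p₀.1, t'))) t • A t = 0 := by
      funext a b
      simp only [Finset.sum_apply, Pi.smul_apply, smul_eq_mul, Pi.zero_apply]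
      have := hno p₀.1 a b
      simp only [hG] at this
      exact this
    have := (Fintype.linearIndependent_iff.1 hAli) (fun t' => g (some (p₀.1, t'))) hfun p₀.2
    exact ho₀ this
  exact exists_nonconst_signed_of_kernel_relation Q G hGinv hG0 hrel hne

end RankBound

/-! ## §2 Never `k` classes over a field with `k` `τ`-embeddings -/

section AnyImage

variable {k : ℕ} {H : Finset (Equiv.Perm (Fin k))}

/-- **NEVER `k` CLASSES.**  `H ⊆ Sym(k)` arbitrary (`k ≥ 2`); for ANY family of at least `k` position sets the signed equations have an integer solution with a non-constant
defect (the rank bound with the one kernel `k·δ − J`, invariant under every permutation): the per-field maxima `k − 1` of the menus are sharp.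
[cite: Serre1977, §2.3 Ex. 2.6] [cite: Lang2002, XIII §4] -/
theorem exists_nonconst_signed_of_card_ge {ι : Type} [Fintype ι] [DecidableEq ι] (Q : ι → Finset (Fin k)) (hk : 2 ≤ k)
    (hcount : k ≤ Fintype.card ι) :
    ∃ u : ι → Fin k → ℤ, (∃ i a b, u i a ≠ u i b) ∧ ∀ σ ∈ H, (∑ i, ∑ a, if σ a ∈ Q i then u i a else -u i a) = 0 := by
  set A : Fin 1 → Fin k → Fin k → ℤ := fun _ a b => (k : ℤ) * (if a = b then 1 else 0) - 1 with hA
  have hδrow : ∀ a : Fin k, ∑ b : Fin k, ((k : ℤ) * (if a = b then 1 else 0) - 1) = 0 := fun a => by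
    rw [Finset.sum_sub_distrib, ← Finset.mul_sum, Finset.sum_ite_eq, if_pos (Finset.mem_univ _), Finset.sum_const, Finset.card_univ,
      Fintype.card_fin]
    simp
  have hδcol : ∀ b : Fin k, ∑ a : Fin k, ((k : ℤ) * (if a = b then 1 else 0) - 1) = 0 := fun b => by
    rw [Finset.sum_sub_distrib, ← Finset.mul_sum, Finset.sum_ite_eq', if_pos (Finset.mem_univ _), Finset.sum_const, Finset.card_univ,
      Fintype.card_fin]
    simp
  refine exists_nonconst_signed_of_independent_kernels Q A (fun σ _ t a b => by simp only [hA, σ.injective.eq_iff])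
    (fun t a => hδrow a) (fun t b => hδcol b) ?_ (by omega) (by rw [one_mul]; exact hcount)
  -- one non-zero vector is independent
  refine Fintype.linearIndependent_iff.2 fun g hg t => ?_
  obtain ⟨a₀⟩ : Nonempty (Fin k) := ⟨⟨0, by omega⟩⟩
  have hAv : ∀ t', A t' a₀ a₀ = (k : ℤ) - 1 := fun t' => by simp [hA]
  have h := congrFun (congrFun hg a₀) a₀
  simp only [Finset.sum_apply, Pi.smul_apply, smul_eq_mul, Pi.zero_apply, Finset.univ_unique, Finset.sum_singleton, hAv] at h
  have hk1 : (k : ℤ) - 1 ≠ 0 := by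
    have : (2 : ℤ) ≤ k := by exact_mod_cast hk
    omega
  have := (mul_eq_zero.1 h).resolve_right hk1
  rwa [Subsingleton.elim t default]

end AnyImage

/-! ## §3 Never three classes over the dihedral pentagon, from the rank bound -/

section DihedralFive

variable {H : Finset (Equiv.Perm (Fin 5))}

/-- **NEVER THREE OVER THE DIHEDRAL PENTAGON (from the rank bound).**  If every `σ ∈ H` is a rotation `x ↦ x + t` or a reflection `x ↦ t − x` of `ℤ/5`, then for ANY family
of at least three position sets the signed equations have an integer solution with a non-constant defect: the two kernels `5·[b − a = ±1] − 2J`, `5·[b − a = ±2] − 2J` are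
invariant, have zero row and column sums, and are independent (`s = 2`, `5 ≤ 2·3`).  Gen 42's `exists_nonconst_signed_of_dihedral_three` in one stroke.
[cite: Serre1977, §5.3] [cite: DixonMortimer1996, §3.2] -/
theorem exists_nonconst_signed_of_dihedral_five_card_ge {ι : Type} [Fintype ι] [DecidableEq ι]
    (hH : ∀ σ ∈ H, ∃ t : Fin 5, (∀ x, σ x = x + t) ∨ (∀ x, σ x = t - x))
    (Q : ι → Finset (Fin 5)) (hcount : 3 ≤ Fintype.card ι) :
    ∃ u : ι → Fin 5 → ℤ, (∃ i a b, u i a ≠ u i b) ∧ ∀ σ ∈ H, (∑ i, ∑ a, if σ a ∈ Q i then u i a else -u i a) = 0 := by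
  -- the two distance kernels of the pentagon, centred
  set A₁ : Fin 5 → Fin 5 → ℤ := fun a b => 5 * (if b - a = 1 ∨ b - a = 4 then 1 else 0) - 2 with hA₁
  set A₂ : Fin 5 → Fin 5 → ℤ := fun a b => 5 * (if b - a = 2 ∨ b - a = 3 then 1 else 0) - 2 with hA₂
  -- a reflection negates `b − a`; the distance classes are symmetric
  have hneg14 : ∀ d : Fin 5, (-d = 1 ∨ -d = 4) ↔ (d = 1 ∨ d = 4) := fun d => by
    constructor
    · rintro (h | h)
      · right; linear_combination (-1 : Fin 5) * h - five_eq_zero_fin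
      · left; linear_combination (-1 : Fin 5) * h - five_eq_zero_fin
    · rintro (h | h)
      · right; linear_combination (-1 : Fin 5) * h - five_eq_zero_fin
      · left; linear_combination (-1 : Fin 5) * h - five_eq_zero_fin
  have hneg23 : ∀ d : Fin 5, (-d = 2 ∨ -d = 3) ↔ (d = 2 ∨ d = 3) := fun d => by
    constructor
    · rintro (h | h)
      · right; linear_combination (-1 : Fin 5) * h - five_eq_zero_fin
      · left; linear_combination (-1 : Fin 5) * h - five_eq_zero_fin
    · rintro (h | h)
      · right; linear_combination (-1 : Fin 5) * h - five_eq_zero_fin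
      · left; linear_combination (-1 : Fin 5) * h - five_eq_zero_fin
  have hinv₁ : ∀ σ ∈ H, ∀ a b, A₁ (σ a) (σ b) = A₁ a b := by
    intro σ hσ a b
    obtain ⟨t, ht | ht⟩ := hH σ hσ
    · simp only [hA₁, ht, add_sub_add_right_eq_sub]
    · have e : t - b - (t - a) = -(b - a) := by ring
      simp only [hA₁, ht, e, hneg14]
  have hinv₂ : ∀ σ ∈ H, ∀ a b, A₂ (σ a) (σ b) = A₂ a b := by
    intro σ hσ a b
    obtain ⟨t, ht | ht⟩ := hH σ hσ
    · simp only [hA₂, ht, add_sub_add_right_eq_sub]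
    · have e : t - b - (t - a) = -(b - a) := by ring
      simp only [hA₂, ht, e, hneg23]
  -- zero row and column sums (substitute `b = a + j`, `a = b − j`)
  have hrow₁ : ∀ a, ∑ b, A₁ a b = 0 := fun a => by
    rw [← Equiv.sum_comp (Equiv.addLeft a) (A₁ a)]
    simp only [hA₁, Equiv.coe_addLeft, add_sub_cancel_left, Fin.sum_univ_five]
    decide
  have hrow₂ : ∀ a, ∑ b, A₂ a b = 0 := fun a => by
    rw [← Equiv.sum_comp (Equiv.addLeft a) (A₂ a)]
    simp only [hA₂, Equiv.coe_addLeft, add_sub_cancel_left, Fin.sum_univ_five]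
    decide
  have hcol₁ : ∀ b, ∑ a, A₁ a b = 0 := fun b => by
    rw [← Equiv.sum_comp (Equiv.subLeft b) (fun a => A₁ a b)]
    simp only [hA₁, Equiv.subLeft_apply, sub_sub_cancel, Fin.sum_univ_five]
    decide
  have hcol₂ : ∀ b, ∑ a, A₂ a b = 0 := fun b => by
    rw [← Equiv.sum_comp (Equiv.subLeft b) (fun a => A₂ a b)]
    simp only [hA₂, Equiv.subLeft_apply, sub_sub_cancel, Fin.sum_univ_five]
    decide
  -- independence: evaluate at the entries `(0, 1)` and `(0, 2)`
  have e₁₁ : A₁ 0 1 = 3 := by simp only [hA₁]; decide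
  have e₂₁ : A₂ 0 1 = -2 := by simp only [hA₂]; decide
  have e₁₂ : A₁ 0 2 = -2 := by simp only [hA₁]; decide
  have e₂₂ : A₂ 0 2 = 3 := by simp only [hA₂]; decide
  have hAli : LinearIndependent ℤ ![A₁, A₂] := by
    refine LinearIndependent.pair_iff.2 fun x y hxy => ?_
    have h1 := congrFun (congrFun hxy 0) 1
    have h2 := congrFun (congrFun hxy 0) 2
    simp only [Pi.add_apply, Pi.smul_apply, smul_eq_mul, Pi.zero_apply, e₁₁, e₂₁, e₁₂, e₂₂] at h1 h2
    constructor <;> omega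
  refine exists_nonconst_signed_of_independent_kernels Q ![A₁, A₂] (fun σ hσ t a b => ?_) (fun t a => ?_) (fun t b => ?_) hAli
    (by norm_num) (by omega)
  · fin_cases t
    · exact hinv₁ σ hσ a b
    · exact hinv₂ σ hσ a b
  · fin_cases t
    · exact hrow₁ a
    · exact hrow₂ a
  · fin_cases t
    · exact hcol₁ b
    · exact hcol₂ b

end DihedralFive

end Summit.HodgeConjecture.CorCM.MultiFieldWeil

end
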